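import Summits.Ventures.YMGap.RobustBall.FourPointSplitsS
import HarnessLib

/-!
# Venture YMGap, track ROBUST-BALL (Y2) — TIER 2: TREE DECAY OF THE FOURTH CUMULANT OF ARBITRARY LOCAL OBSERVABLES, UNIFORMLY ON THE WEIGHTED BALL

HONEST FRAMING. WHAT THIS IS: a venture file (cell `pub-ymgap`, track Y2 ROBUST-BALL, seat rb-p1, theorems only): the BALL twin of ds-1's tree decay of the
connected four-point function of the Wilson state (`Thresholds/ConnectedFourPointDecay.lean`).  Member `W ∈ MemBallZdS a Λ_t t` inside the one-link pair
door `ρ < 1` (`t ≥ 0`), ANY DLR state `μ`, four bounded measurable local Frobenius-Lipschitz observables `f, g, h, k` (supports `Δ_•`, vectors `δ_•` with sums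
`S_•` — passed as equations —, bounds `M_•`); `u₄` in ds-1's derivative form; the six set distances between the four supports:
* `spanningTree_of_cuts_bool` — the threshold-graph lemma for `K₄` (a decidable tautology on six Booleans): if each of the seven bipartitions of four
  vertices has a marked crossing edge, some spanning tree (one of 16) is marked; `exp_neg_le_treeSum` — hence, WITHOUT ANY TRIANGLE INEQUALITY (set
  distances are not a metric), `e^{−tθ} ≤ Σ_{16 trees T} Π_{e∈T} e^{−(t/3) d_e}` as soon as every cut has a crossing distance `≤ θ`;
* ★★ `abs_fourPoint_le_tree_S` — TREE DECAY: with `B₄` the sum of the seven split coefficients of `FourPointSplitsS` (four isolated slots, three pairs),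
  `|u₄(f;g;h;k)| ≤ 48N B₄ Σ_T Π_{e∈T} e^{−(t/3) d_e}` — the seven Dobrushin–Shlosman splits (isolated / pair bounds and the transpositions of
  `ConnectedFourPointAlgebra`), the best cut decaying at `θ = max` of the seven union distances, and the threshold-graph lemma.  Every one of the 16 terms is a
  product over a spanning tree of the four supports: the per-term input of the third-order susceptibility `Σ_{X,Y,Z} u₄(F; V_X; V_Y; V_Z)` and of `C³` along the
  lines of the ball (successor files).
WHAT THIS IS NOT: sharp for large supports; one-sided Dobrushin-comparison constants at lattice strong coupling; nothing about the continuum limit or a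
Clay-sense mass gap.
-/

noncomputable section

open MeasureTheory Function Finset ProbabilityTheory Real
open scoped NNReal
open Literature.Probability.LatticeModels
open Literature.Probability.LatticeModels.DobrushinMetric
open Literature.MathematicalPhysics.QuantumLattice
open Literature.MathematicalPhysics.QuantumFieldTheory hiding ZdEdge
open Summit.Ventures.YMGap.CouplingResponse (fourPoint_swap_xy fourPoint_swap_yz fourPoint_swap_zw)

namespace Summit.Ventures.YMGap.RobustBall

variable {d N : ℕ}

/-! ### The threshold-graph lemma for four vertices -/

/-- Threshold-graph lemma for `K₄`: if each of the seven cuts has a crossing edge marked `true`, some spanning tree (16 of them) is all `true`. -/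
theorem spanningTree_of_cuts_bool : ∀ (b01 b02 b03 b12 b13 b23 : Bool),
    (b03 || b13 || b23) = true → (b02 || b12 || b23) = true → (b01 || b12 || b13) = true → (b01 || b02 || b03) = true →
    (b02 || b03 || b12 || b13) = true → (b01 || b03 || b12 || b23) = true → (b01 || b02 || b13 || b23) = true →
    ((b01 && b02 && b03) || (b01 && b12 && b13) || (b02 && b12 && b23) || (b03 && b13 && b23) ||
      (b01 && b12 && b23) || (b01 && b13 && b23) || (b02 && b12 && b13) || (b02 && b23 && b13) || (b03 && b13 && b12) ||
      (b03 && b23 && b12) || (b01 && b02 && b23) || (b01 && b03 && b23) || (b02 && b01 && b13) || (b02 && b03 && b13) ||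
      (b03 && b01 && b12) || (b03 && b02 && b12)) = true := by
  decide

/-- **Tree bound from the seven cuts.**  `t ≥ 0`; six "distances" `d_{ab}`; if for each of the seven bipartitions of `{0,1,2,3}` the minimum of the
crossing distances is `≤ θ`, then `e^{−tθ} ≤ Σ_{16 spanning trees T} Π_{e∈T} e^{−(t/3) d_e}`. -/
theorem exp_neg_le_treeSum {t θ d01 d02 d03 d12 d13 d23 : ℝ} (ht : 0 ≤ t)
    (c3 : min d03 (min d13 d23) ≤ θ) (c2 : min d02 (min d12 d23) ≤ θ) (c1 : min d01 (min d12 d13) ≤ θ) (c0 : min d01 (min d02 d03) ≤ θ)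
    (c01 : min (min d02 d03) (min d12 d13) ≤ θ) (c02 : min (min d01 d03) (min d12 d23) ≤ θ) (c03 : min (min d01 d02) (min d13 d23) ≤ θ) :
    exp (-(t * θ)) ≤
      exp (-(t / 3 * d01)) * exp (-(t / 3 * d02)) * exp (-(t / 3 * d03)) + exp (-(t / 3 * d01)) * exp (-(t / 3 * d12)) * exp (-(t / 3 * d13)) +
      exp (-(t / 3 * d02)) * exp (-(t / 3 * d12)) * exp (-(t / 3 * d23)) + exp (-(t / 3 * d03)) * exp (-(t / 3 * d13)) * exp (-(t / 3 * d23)) +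
      exp (-(t / 3 * d01)) * exp (-(t / 3 * d12)) * exp (-(t / 3 * d23)) + exp (-(t / 3 * d01)) * exp (-(t / 3 * d13)) * exp (-(t / 3 * d23)) +
      exp (-(t / 3 * d02)) * exp (-(t / 3 * d12)) * exp (-(t / 3 * d13)) + exp (-(t / 3 * d02)) * exp (-(t / 3 * d23)) * exp (-(t / 3 * d13)) +
      exp (-(t / 3 * d03)) * exp (-(t / 3 * d13)) * exp (-(t / 3 * d12)) + exp (-(t / 3 * d03)) * exp (-(t / 3 * d23)) * exp (-(t / 3 * d12)) +
      exp (-(t / 3 * d01)) * exp (-(t / 3 * d02)) * exp (-(t / 3 * d23)) + exp (-(t / 3 * d01)) * exp (-(t / 3 * d03)) * exp (-(t / 3 * d23)) +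
      exp (-(t / 3 * d02)) * exp (-(t / 3 * d01)) * exp (-(t / 3 * d13)) + exp (-(t / 3 * d02)) * exp (-(t / 3 * d03)) * exp (-(t / 3 * d13)) +
      exp (-(t / 3 * d03)) * exp (-(t / 3 * d01)) * exp (-(t / 3 * d12)) + exp (-(t / 3 * d03)) * exp (-(t / 3 * d02)) * exp (-(t / 3 * d12)) := by
  -- one marked spanning tree
  have key : ∀ {p q r : ℝ}, p ≤ θ → q ≤ θ → r ≤ θ → exp (-(t * θ)) ≤ exp (-(t / 3 * p)) * exp (-(t / 3 * q)) * exp (-(t / 3 * r)) := by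
    intro p q r hp hq hr
    rw [← Real.exp_add, ← Real.exp_add]
    exact exp_le_exp.2 (by nlinarith)
  have hb := spanningTree_of_cuts_bool (decide (d01 ≤ θ)) (decide (d02 ≤ θ)) (decide (d03 ≤ θ)) (decide (d12 ≤ θ)) (decide (d13 ≤ θ))
    (decide (d23 ≤ θ)) (by simpa [Bool.or_eq_true, decide_eq_true_eq, min_le_iff, or_assoc] using c3)
    (by simpa [Bool.or_eq_true, decide_eq_true_eq, min_le_iff, or_assoc] using c2)
    (by simpa [Bool.or_eq_true, decide_eq_true_eq, min_le_iff, or_assoc] using c1)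
    (by simpa [Bool.or_eq_true, decide_eq_true_eq, min_le_iff, or_assoc] using c0)
    (by simpa [Bool.or_eq_true, decide_eq_true_eq, min_le_iff, or_assoc] using c01)
    (by simpa [Bool.or_eq_true, decide_eq_true_eq, min_le_iff, or_assoc] using c02)
    (by simpa [Bool.or_eq_true, decide_eq_true_eq, min_le_iff, or_assoc] using c03)
  simp only [Bool.or_eq_true, Bool.and_eq_true, decide_eq_true_eq, and_assoc, or_assoc] at hb
  set x01 := exp (-(t / 3 * d01)); set x02 := exp (-(t / 3 * d02)); set x03 := exp (-(t / 3 * d03))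
  set x12 := exp (-(t / 3 * d12)); set x13 := exp (-(t / 3 * d13)); set x23 := exp (-(t / 3 * d23))
  have p01 : 0 ≤ x01 := (exp_pos _).le; have p02 : 0 ≤ x02 := (exp_pos _).le; have p03 : 0 ≤ x03 := (exp_pos _).le
  have p12 : 0 ≤ x12 := (exp_pos _).le; have p13 : 0 ≤ x13 := (exp_pos _).le; have p23 : 0 ≤ x23 := (exp_pos _).le
  have q1 : 0 ≤ x01 * x02 * x03 := by positivity
  have q2 : 0 ≤ x01 * x12 * x13 := by positivity
  have q3 : 0 ≤ x02 * x12 * x23 := by positivity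
  have q4 : 0 ≤ x03 * x13 * x23 := by positivity
  have q5 : 0 ≤ x01 * x12 * x23 := by positivity
  have q6 : 0 ≤ x01 * x13 * x23 := by positivity
  have q7 : 0 ≤ x02 * x12 * x13 := by positivity
  have q8 : 0 ≤ x02 * x23 * x13 := by positivity
  have q9 : 0 ≤ x03 * x13 * x12 := by positivity
  have q10 : 0 ≤ x03 * x23 * x12 := by positivity
  have q11 : 0 ≤ x01 * x02 * x23 := by positivity
  have q12 : 0 ≤ x01 * x03 * x23 := by positivity
  have q13 : 0 ≤ x02 * x01 * x13 := by positivity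
  have q14 : 0 ≤ x02 * x03 * x13 := by positivity
  have q15 : 0 ≤ x03 * x01 * x12 := by positivity
  have q16 : 0 ≤ x03 * x02 * x12 := by positivity
  rcases hb with ⟨a, b, c⟩ | ⟨a, b, c⟩ | ⟨a, b, c⟩ | ⟨a, b, c⟩ | ⟨a, b, c⟩ | ⟨a, b, c⟩ | ⟨a, b, c⟩ | ⟨a, b, c⟩ | ⟨a, b, c⟩ | ⟨a, b, c⟩ |
    ⟨a, b, c⟩ | ⟨a, b, c⟩ | ⟨a, b, c⟩ | ⟨a, b, c⟩ | ⟨a, b, c⟩ | ⟨a, b, c⟩ <;>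
    linarith [key a b c]

/-- `min (d(A,B)) (d(A,C)) ≤ d(A, B ∪ C)` (junk-safe). -/
theorem min_setDistEdges_le_union_right (A B C : Finset (ZdEdge d)) :
    min (setDistEdges A B) (setDistEdges A C) ≤ setDistEdges A (B ∪ C) := by
  rw [setDistEdges_comm A B, setDistEdges_comm A C, setDistEdges_comm A (B ∪ C)]; exact min_setDistEdges_le_union B C A

/-! ### Tree decay -/

section SUN

variable {W : Potential (ZdEdge d) (Matrix.specialUnitaryGroup (Fin N) ℂ)}

/-- Local shorthand: the connected three-point function `u₃(X; Y; Z)` under `μ`. -/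
local notation3 (prettyPrint := false) "U₃[" X ";" Y ";" Z ";" μ "]" =>
  cov[fun ω => X ω * Y ω, Z; μ] - (∫ ω, X ω ∂μ) * cov[Y, Z; μ] - (∫ ω, Y ω ∂μ) * cov[X, Z; μ]

/-- Local shorthand: the connected four-point function in derivative form `u₄(X; Y; Z; W)` under `μ`. -/
local notation3 (prettyPrint := false) "U₄[" X ";" Y ";" Z ";" W' ";" μ "]" =>
  (cov[fun ω => (X ω * Y ω) * Z ω, W'; μ] - (∫ ω, X ω * Y ω ∂μ) * cov[Z, W'; μ] - (∫ ω, Z ω ∂μ) * cov[fun ω => X ω * Y ω, W'; μ])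
  - cov[X, W'; μ] * cov[Y, Z; μ] - (∫ ω, X ω ∂μ) * U₃[Y ; Z ; W' ; μ]
  - cov[Y, W'; μ] * cov[X, Z; μ] - (∫ ω, Y ω ∂μ) * U₃[X ; Z ; W' ; μ]

/-- ★★ **TREE DECAY OF THE FOURTH CUMULANT, uniformly on the weighted ball.**  Member `W ∈ MemBallZdS a Λ_t t` in the pair door (`t ≥ 0`), ANY DLR `μ`,
`f, g, h, k` bounded measurable local Frobenius-Lipschitz (`S_• = Σδ_•` passed as equations); `B₄` = the sum of the seven split coefficients.  Then
`|u₄(f;g;h;k)| ≤ 48N B₄ Σ_{16 spanning trees T} Π_{{a,b}∈T} e^{−(t/3) d(Δ_a, Δ_b)}`. -/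
theorem abs_fourPoint_le_tree_S (hd : 1 ≤ d) (hN : 1 ≤ N) {β b c v a Λt t : ℝ}
    (hc : 0 ≤ c) (hv : 0 ≤ v) (hb : |β| * (2 * ((d : ℝ) - 1)) ≤ b)
    (hP : ∀ B : Matrix (Fin N) (Fin N) ℂ, matrixOpNorm B ≤ b →
      ∀ (ψ : Matrix.specialUnitaryGroup (Fin N) ℂ → ℝ) (M : ℝ), 0 ≤ M →
        (∀ x y, |ψ x - ψ y| ≤ M * suFrobDist x y) →
        Var[ψ; (haarProbability (Matrix.specialUnitaryGroup (Fin N) ℂ)).tilted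
          fun g => (N : ℝ) * ((g : Matrix (Fin N) (Fin N) ℂ) * B).trace.re] ≤ c * M ^ 2)
    (hVB : ∀ B : Matrix (Fin N) (Fin N) ℂ, matrixOpNorm B ≤ b → ∀ Δ : Matrix (Fin N) (Fin N) ℂ,
      Var[fun g : Matrix.specialUnitaryGroup (Fin N) ℂ =>
          (N : ℝ) * ((g : Matrix (Fin N) (Fin N) ℂ) * Δ).trace.re;
        (haarProbability (Matrix.specialUnitaryGroup (Fin N) ℂ)).tilted
          fun g => (N : ℝ) * ((g : Matrix (Fin N) (Fin N) ℂ) * B).trace.re] ≤ v * frobNorm Δ ^ 2)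
    (ht : 0 ≤ t) (hρ : 6 * ((d : ℝ) - 1) * |β| * (exp a * exp t * Real.sqrt (c * v)) + exp (a / 2) * Real.sqrt c * Λt < 1)
    (hW : MemBallZdS a Λt t W) {μ : Measure (LGConfig d (Matrix.specialUnitaryGroup (Fin N) ℂ))}
    (hμ : μ ∈ perturbedGibbsMeasuresS (d := d) (fundamentalRep (Fin N)) (N * β) W)
    {f : LGConfig d (Matrix.specialUnitaryGroup (Fin N) ℂ) → ℝ} (hfm : Measurable f) {Δf : Finset (ZdEdge d)}
    (hfdep : DependsOn f (↑Δf : Set (ZdEdge d))) {Mf : ℝ} (hMf : ∀ σ, |f σ| ≤ Mf) {δf : ZdEdge d → ℝ} (hδf : IsLipBound suFrobDist f δf)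
    {g : LGConfig d (Matrix.specialUnitaryGroup (Fin N) ℂ) → ℝ} (hgm : Measurable g) {Δg : Finset (ZdEdge d)}
    (hgdep : DependsOn g (↑Δg : Set (ZdEdge d))) {Mg : ℝ} (hMg : ∀ σ, |g σ| ≤ Mg) {δg : ZdEdge d → ℝ} (hδg : IsLipBound suFrobDist g δg)
    {h : LGConfig d (Matrix.specialUnitaryGroup (Fin N) ℂ) → ℝ} (hhm : Measurable h) {Δh : Finset (ZdEdge d)}
    (hhdep : DependsOn h (↑Δh : Set (ZdEdge d))) {Mh : ℝ} (hMh : ∀ σ, |h σ| ≤ Mh) {δh : ZdEdge d → ℝ} (hδh : IsLipBound suFrobDist h δh)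
    {k : LGConfig d (Matrix.specialUnitaryGroup (Fin N) ℂ) → ℝ} (hkm : Measurable k) {Δk : Finset (ZdEdge d)}
    (hkdep : DependsOn k (↑Δk : Set (ZdEdge d))) {Mk : ℝ} (hMk : ∀ σ, |k σ| ≤ Mk) {δk : ZdEdge d → ℝ} (hδk : IsLipBound suFrobDist k δk)
    {Sf Sg Sh Sk : ℝ} (hSf : Sf = ∑ y ∈ Δf, δf y) (hSg : Sg = ∑ y ∈ Δg, δg y) (hSh : Sh = ∑ y ∈ Δh, δh y) (hSk : Sk = ∑ y ∈ Δk, δk y) :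
    |U₄[f ; g ; h ; k ; μ]| ≤
      48 * N * ((Mf * Mg * Sh + Mf * Mh * Sg + Mg * Mh * Sf) * Sk + (Mf * Mg * Sk + Mf * Mk * Sg + Mg * Mk * Sf) * Sh +
        (Mf * Mh * Sk + Mf * Mk * Sh + Mh * Mk * Sf) * Sg + (Mg * Mh * Sk + Mg * Mk * Sh + Mh * Mk * Sg) * Sf +
        (Mf * Sg + Mg * Sf) * (Mh * Sk + Mk * Sh) + (Mf * Sh + Mh * Sf) * (Mg * Sk + Mk * Sg) + (Mf * Sk + Mk * Sf) * (Mg * Sh + Mh * Sg)) *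
      (exp (-(t / 3 * setDistEdges Δf Δg)) * exp (-(t / 3 * setDistEdges Δf Δh)) * exp (-(t / 3 * setDistEdges Δf Δk)) +
      exp (-(t / 3 * setDistEdges Δf Δg)) * exp (-(t / 3 * setDistEdges Δg Δh)) * exp (-(t / 3 * setDistEdges Δg Δk)) +
      exp (-(t / 3 * setDistEdges Δf Δh)) * exp (-(t / 3 * setDistEdges Δg Δh)) * exp (-(t / 3 * setDistEdges Δh Δk)) +
      exp (-(t / 3 * setDistEdges Δf Δk)) * exp (-(t / 3 * setDistEdges Δg Δk)) * exp (-(t / 3 * setDistEdges Δh Δk)) +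
      exp (-(t / 3 * setDistEdges Δf Δg)) * exp (-(t / 3 * setDistEdges Δg Δh)) * exp (-(t / 3 * setDistEdges Δh Δk)) +
      exp (-(t / 3 * setDistEdges Δf Δg)) * exp (-(t / 3 * setDistEdges Δg Δk)) * exp (-(t / 3 * setDistEdges Δh Δk)) +
      exp (-(t / 3 * setDistEdges Δf Δh)) * exp (-(t / 3 * setDistEdges Δg Δh)) * exp (-(t / 3 * setDistEdges Δg Δk)) +
      exp (-(t / 3 * setDistEdges Δf Δh)) * exp (-(t / 3 * setDistEdges Δh Δk)) * exp (-(t / 3 * setDistEdges Δg Δk)) +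
      exp (-(t / 3 * setDistEdges Δf Δk)) * exp (-(t / 3 * setDistEdges Δg Δk)) * exp (-(t / 3 * setDistEdges Δg Δh)) +
      exp (-(t / 3 * setDistEdges Δf Δk)) * exp (-(t / 3 * setDistEdges Δh Δk)) * exp (-(t / 3 * setDistEdges Δg Δh)) +
      exp (-(t / 3 * setDistEdges Δf Δg)) * exp (-(t / 3 * setDistEdges Δf Δh)) * exp (-(t / 3 * setDistEdges Δh Δk)) +
      exp (-(t / 3 * setDistEdges Δf Δg)) * exp (-(t / 3 * setDistEdges Δf Δk)) * exp (-(t / 3 * setDistEdges Δh Δk)) +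
      exp (-(t / 3 * setDistEdges Δf Δh)) * exp (-(t / 3 * setDistEdges Δf Δg)) * exp (-(t / 3 * setDistEdges Δg Δk)) +
      exp (-(t / 3 * setDistEdges Δf Δh)) * exp (-(t / 3 * setDistEdges Δf Δk)) * exp (-(t / 3 * setDistEdges Δg Δk)) +
      exp (-(t / 3 * setDistEdges Δf Δk)) * exp (-(t / 3 * setDistEdges Δf Δg)) * exp (-(t / 3 * setDistEdges Δg Δh)) +
      exp (-(t / 3 * setDistEdges Δf Δk)) * exp (-(t / 3 * setDistEdges Δf Δh)) * exp (-(t / 3 * setDistEdges Δg Δh))) := by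
  classical
  have hμP : IsGibbsMeasure (perturbedYMS (d := d) (fundamentalRep (Fin N)) (N * β) W) μ := hμ
  haveI := hμP.isProbabilityMeasure
  have hMf0 : 0 ≤ Mf := (abs_nonneg _).trans (hMf 1); have hMg0 : 0 ≤ Mg := (abs_nonneg _).trans (hMg 1)
  have hMh0 : 0 ≤ Mh := (abs_nonneg _).trans (hMh 1); have hMk0 : 0 ≤ Mk := (abs_nonneg _).trans (hMk 1)
  have hSf0 : 0 ≤ Sf := hSf ▸ sum_nonneg fun y _ => hδf.nonneg y; have hSg0 : 0 ≤ Sg := hSg ▸ sum_nonneg fun y _ => hδg.nonneg y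
  have hSh0 : 0 ≤ Sh := hSh ▸ sum_nonneg fun y _ => hδh.nonneg y; have hSk0 : 0 ≤ Sk := hSk ▸ sum_nonneg fun y _ => hδk.nonneg y
  have hNN : (0 : ℝ) ≤ N := Nat.cast_nonneg N
  -- the seven splits
  have s1 := abs_fourPoint_le_isolated_S hd hN hc hv hb hP hVB ht hρ hW hμ hfm hfdep hMf hδf hgm hgdep hMg hδg hhm hhdep hMh hδh hkm hkdep hMk hδk
  have s2 := abs_fourPoint_le_isolated_S hd hN hc hv hb hP hVB ht hρ hW hμ hfm hfdep hMf hδf hgm hgdep hMg hδg hkm hkdep hMk hδk hhm hhdep hMh hδh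
  rw [← fourPoint_swap_zw hfm hgm hhm hkm hMf hMg hMh hMk] at s2
  have s3 := abs_fourPoint_le_isolated_S hd hN hc hv hb hP hVB ht hρ hW hμ hfm hfdep hMf hδf hhm hhdep hMh hδh hkm hkdep hMk hδk hgm hgdep hMg hδg
  rw [← fourPoint_swap_zw hfm hhm hgm hkm hMf hMh hMg hMk, ← fourPoint_swap_yz hfm hgm hhm hkm hMf hMg hMh hMk] at s3
  have s4 := abs_fourPoint_le_isolated_S hd hN hc hv hb hP hVB ht hρ hW hμ hgm hgdep hMg hδg hhm hhdep hMh hδh hkm hkdep hMk hδk hfm hfdep hMf hδf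
  rw [← fourPoint_swap_zw hgm hhm hfm hkm hMg hMh hMf hMk, ← fourPoint_swap_yz hgm hfm hhm hkm hMg hMf hMh hMk,
    ← fourPoint_swap_xy hfm hgm hhm hkm hMf hMg hMh hMk] at s4
  have s5 := abs_fourPoint_le_pair_S hd hN hc hv hb hP hVB ht hρ hW hμ hfm hfdep hMf hδf hgm hgdep hMg hδg hhm hhdep hMh hδh hkm hkdep hMk hδk
  have s6 := abs_fourPoint_le_pair_S hd hN hc hv hb hP hVB ht hρ hW hμ hfm hfdep hMf hδf hhm hhdep hMh hδh hgm hgdep hMg hδg hkm hkdep hMk hδk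
  rw [← fourPoint_swap_yz hfm hgm hhm hkm hMf hMg hMh hMk] at s6
  have s7 := abs_fourPoint_le_pair_S hd hN hc hv hb hP hVB ht hρ hW hμ hfm hfdep hMf hδf hkm hkdep hMk hδk hgm hgdep hMg hδg hhm hhdep hMh hδh
  rw [← fourPoint_swap_yz hfm hgm hkm hhm hMf hMg hMk hMh, ← fourPoint_swap_zw hfm hgm hhm hkm hMf hMg hMh hMk] at s7
  rw [← hSf, ← hSg, ← hSh, ← hSk] at s1 s2 s3 s4 s5 s6 s7
  -- abbreviations
  obtain ⟨U, hU⟩ : ∃ x : ℝ, x = |U₄[f ; g ; h ; k ; μ]| := ⟨_, rfl⟩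
  rw [← hU] at s1 s2 s3 s4 s5 s6 s7 ⊢
  obtain ⟨B, hB⟩ : ∃ x : ℝ, x = ((Mf * Mg * Sh + Mf * Mh * Sg + Mg * Mh * Sf) * Sk + (Mf * Mg * Sk + Mf * Mk * Sg + Mg * Mk * Sf) * Sh +
        (Mf * Mh * Sk + Mf * Mk * Sh + Mh * Mk * Sf) * Sg + (Mg * Mh * Sk + Mg * Mk * Sh + Mh * Mk * Sg) * Sf +
        (Mf * Sg + Mg * Sf) * (Mh * Sk + Mk * Sh) + (Mf * Sh + Mh * Sf) * (Mg * Sk + Mk * Sg) + (Mf * Sk + Mk * Sf) * (Mg * Sh + Mh * Sg)) := ⟨_, rfl⟩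
  rw [← hB]
  obtain ⟨g1, hg1⟩ : ∃ x : ℝ, x = setDistEdges (Δf ∪ Δg ∪ Δh) Δk := ⟨_, rfl⟩
  obtain ⟨g2, hg2⟩ : ∃ x : ℝ, x = setDistEdges (Δf ∪ Δg ∪ Δk) Δh := ⟨_, rfl⟩
  obtain ⟨g3, hg3⟩ : ∃ x : ℝ, x = setDistEdges (Δf ∪ Δh ∪ Δk) Δg := ⟨_, rfl⟩
  obtain ⟨g4, hg4⟩ : ∃ x : ℝ, x = setDistEdges (Δg ∪ Δh ∪ Δk) Δf := ⟨_, rfl⟩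
  obtain ⟨g5, hg5⟩ : ∃ x : ℝ, x = setDistEdges (Δf ∪ Δg) (Δh ∪ Δk) := ⟨_, rfl⟩
  obtain ⟨g6, hg6⟩ : ∃ x : ℝ, x = setDistEdges (Δf ∪ Δh) (Δg ∪ Δk) := ⟨_, rfl⟩
  obtain ⟨g7, hg7⟩ : ∃ x : ℝ, x = setDistEdges (Δf ∪ Δk) (Δg ∪ Δh) := ⟨_, rfl⟩
  rw [← hg1] at s1; rw [← hg2] at s2; rw [← hg3] at s3; rw [← hg4] at s4; rw [← hg5] at s5; rw [← hg6] at s6; rw [← hg7] at s7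
  -- every split coefficient is at most `B`
  obtain ⟨C1, hC1⟩ : ∃ x : ℝ, x = (Mf * Mg * Sh + Mf * Mh * Sg + Mg * Mh * Sf) * Sk := ⟨_, rfl⟩
  have hC10 : 0 ≤ C1 := by
    rw [hC1]
    exact (mul_nonneg (add_nonneg (add_nonneg (mul_nonneg (mul_nonneg hMf0 hMg0) hSh0) (mul_nonneg (mul_nonneg hMf0 hMh0) hSg0)) (mul_nonneg (mul_nonneg hMg0 hMh0) hSf0)) hSk0)
  have s1' : U ≤ 48 * N * C1 * exp (-(t * g1)) := s1.trans (le_of_eq (by rw [hC1]; ring))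
  obtain ⟨C2, hC2⟩ : ∃ x : ℝ, x = (Mf * Mg * Sk + Mf * Mk * Sg + Mg * Mk * Sf) * Sh := ⟨_, rfl⟩
  have hC20 : 0 ≤ C2 := by
    rw [hC2]
    exact (mul_nonneg (add_nonneg (add_nonneg (mul_nonneg (mul_nonneg hMf0 hMg0) hSk0) (mul_nonneg (mul_nonneg hMf0 hMk0) hSg0)) (mul_nonneg (mul_nonneg hMg0 hMk0) hSf0)) hSh0)
  have s2' : U ≤ 48 * N * C2 * exp (-(t * g2)) := s2.trans (le_of_eq (by rw [hC2]; ring))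
  obtain ⟨C3, hC3⟩ : ∃ x : ℝ, x = (Mf * Mh * Sk + Mf * Mk * Sh + Mh * Mk * Sf) * Sg := ⟨_, rfl⟩
  have hC30 : 0 ≤ C3 := by
    rw [hC3]
    exact (mul_nonneg (add_nonneg (add_nonneg (mul_nonneg (mul_nonneg hMf0 hMh0) hSk0) (mul_nonneg (mul_nonneg hMf0 hMk0) hSh0)) (mul_nonneg (mul_nonneg hMh0 hMk0) hSf0)) hSg0)
  have s3' : U ≤ 48 * N * C3 * exp (-(t * g3)) := s3.trans (le_of_eq (by rw [hC3]; ring))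
  obtain ⟨C4, hC4⟩ : ∃ x : ℝ, x = (Mg * Mh * Sk + Mg * Mk * Sh + Mh * Mk * Sg) * Sf := ⟨_, rfl⟩
  have hC40 : 0 ≤ C4 := by
    rw [hC4]
    exact (mul_nonneg (add_nonneg (add_nonneg (mul_nonneg (mul_nonneg hMg0 hMh0) hSk0) (mul_nonneg (mul_nonneg hMg0 hMk0) hSh0)) (mul_nonneg (mul_nonneg hMh0 hMk0) hSg0)) hSf0)
  have s4' : U ≤ 48 * N * C4 * exp (-(t * g4)) := s4.trans (le_of_eq (by rw [hC4]; ring))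
  obtain ⟨C5, hC5⟩ : ∃ x : ℝ, x = (Mf * Sg + Mg * Sf) * (Mh * Sk + Mk * Sh) := ⟨_, rfl⟩
  have hC50 : 0 ≤ C5 := by
    rw [hC5]
    exact (mul_nonneg (add_nonneg (mul_nonneg hMf0 hSg0) (mul_nonneg hMg0 hSf0)) (add_nonneg (mul_nonneg hMh0 hSk0) (mul_nonneg hMk0 hSh0)))
  have s5' : U ≤ 48 * N * C5 * exp (-(t * g5)) := s5.trans (le_of_eq (by rw [hC5]; ring))
  obtain ⟨C6, hC6⟩ : ∃ x : ℝ, x = (Mf * Sh + Mh * Sf) * (Mg * Sk + Mk * Sg) := ⟨_, rfl⟩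
  have hC60 : 0 ≤ C6 := by
    rw [hC6]
    exact (mul_nonneg (add_nonneg (mul_nonneg hMf0 hSh0) (mul_nonneg hMh0 hSf0)) (add_nonneg (mul_nonneg hMg0 hSk0) (mul_nonneg hMk0 hSg0)))
  have s6' : U ≤ 48 * N * C6 * exp (-(t * g6)) := s6.trans (le_of_eq (by rw [hC6]; ring))
  obtain ⟨C7, hC7⟩ : ∃ x : ℝ, x = (Mf * Sk + Mk * Sf) * (Mg * Sh + Mh * Sg) := ⟨_, rfl⟩
  have hC70 : 0 ≤ C7 := by
    rw [hC7]
    exact (mul_nonneg (add_nonneg (mul_nonneg hMf0 hSk0) (mul_nonneg hMk0 hSf0)) (add_nonneg (mul_nonneg hMg0 hSh0) (mul_nonneg hMh0 hSg0)))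
  have s7' : U ≤ 48 * N * C7 * exp (-(t * g7)) := s7.trans (le_of_eq (by rw [hC7]; ring))
  have h48 : (0 : ℝ) ≤ 48 * N := mul_nonneg (by norm_num) hNN
  have hBC : B = C1 + C2 + C3 + C4 + C5 + C6 + C7 := by rw [hB, hC1, hC2, hC3, hC4, hC5, hC6, hC7]
  have k1 : U ≤ 48 * N * B * exp (-(t * g1)) := by
    refine s1'.trans ?_
    have hle : C1 ≤ B := by rw [hBC]; linarith
    exact mul_le_mul_of_nonneg_right (mul_le_mul_of_nonneg_left hle h48) (exp_pos _).le
  have k2 : U ≤ 48 * N * B * exp (-(t * g2)) := by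
    refine s2'.trans ?_
    have hle : C2 ≤ B := by rw [hBC]; linarith
    exact mul_le_mul_of_nonneg_right (mul_le_mul_of_nonneg_left hle h48) (exp_pos _).le
  have k3 : U ≤ 48 * N * B * exp (-(t * g3)) := by
    refine s3'.trans ?_
    have hle : C3 ≤ B := by rw [hBC]; linarith
    exact mul_le_mul_of_nonneg_right (mul_le_mul_of_nonneg_left hle h48) (exp_pos _).le
  have k4 : U ≤ 48 * N * B * exp (-(t * g4)) := by
    refine s4'.trans ?_
    have hle : C4 ≤ B := by rw [hBC]; linarith
    exact mul_le_mul_of_nonneg_right (mul_le_mul_of_nonneg_left hle h48) (exp_pos _).le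
  have k5 : U ≤ 48 * N * B * exp (-(t * g5)) := by
    refine s5'.trans ?_
    have hle : C5 ≤ B := by rw [hBC]; linarith
    exact mul_le_mul_of_nonneg_right (mul_le_mul_of_nonneg_left hle h48) (exp_pos _).le
  have k6 : U ≤ 48 * N * B * exp (-(t * g6)) := by
    refine s6'.trans ?_
    have hle : C6 ≤ B := by rw [hBC]; linarith
    exact mul_le_mul_of_nonneg_right (mul_le_mul_of_nonneg_left hle h48) (exp_pos _).le
  have k7 : U ≤ 48 * N * B * exp (-(t * g7)) := by
    refine s7'.trans ?_
    have hle : C7 ≤ B := by rw [hBC]; linarith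
    exact mul_le_mul_of_nonneg_right (mul_le_mul_of_nonneg_left hle h48) (exp_pos _).le
  have hB0 : 0 ≤ B := by rw [hBC]; linarith
  -- the best cut: `θ` = the largest of the seven union distances
  obtain ⟨θ, hθ⟩ : ∃ x : ℝ, x = max g1 (max g2 (max g3 (max g4 (max g5 (max g6 g7))))) := ⟨_, rfl⟩
  have hUθ : U ≤ 48 * N * B * exp (-(t * θ)) := by
    rw [hθ]
    rcases max_choice g6 g7 with h67 | h67 <;> rcases max_choice g5 (max g6 g7) with h5 | h5 <;>
      rcases max_choice g4 (max g5 (max g6 g7)) with h4 | h4 <;> rcases max_choice g3 (max g4 (max g5 (max g6 g7))) with h3 | h3 <;>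
      rcases max_choice g2 (max g3 (max g4 (max g5 (max g6 g7)))) with h2 | h2 <;>
      rcases max_choice g1 (max g2 (max g3 (max g4 (max g5 (max g6 g7))))) with h1 | h1 <;>
      first
        | (rw [h1]; exact k1)
        | (rw [h1, h2]; exact k2)
        | (rw [h1, h2, h3]; exact k3)
        | (rw [h1, h2, h3, h4]; exact k4)
        | (rw [h1, h2, h3, h4, h5]; exact k5)
        | (rw [h1, h2, h3, h4, h5, h67]; exact k6)
        | (rw [h1, h2, h3, h4, h5, h67]; exact k7)
  have le1 : g1 ≤ θ := by rw [hθ]; exact le_max_left _ _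
  have le2 : g2 ≤ θ := by rw [hθ]; exact le_max_of_le_right (le_max_left _ _)
  have le3 : g3 ≤ θ := by rw [hθ]; exact le_max_of_le_right (le_max_of_le_right (le_max_left _ _))
  have le4 : g4 ≤ θ := by rw [hθ]; exact le_max_of_le_right (le_max_of_le_right (le_max_of_le_right (le_max_left _ _)))
  have le5 : g5 ≤ θ := by rw [hθ]; exact le_max_of_le_right (le_max_of_le_right (le_max_of_le_right (le_max_of_le_right (le_max_left _ _))))
  have le6 : g6 ≤ θ := by
    rw [hθ]; exact le_max_of_le_right (le_max_of_le_right (le_max_of_le_right (le_max_of_le_right (le_max_of_le_right (le_max_left _ _)))))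
  have le7 : g7 ≤ θ := by
    rw [hθ]; exact le_max_of_le_right (le_max_of_le_right (le_max_of_le_right (le_max_of_le_right (le_max_of_le_right (le_max_right _ _)))))
  -- the cut hypotheses of the threshold-graph lemma (set distances of unions dominate the minima of the crossing distances)
  have c3 : min (setDistEdges Δf Δk) (min (setDistEdges Δg Δk) (setDistEdges Δh Δk)) ≤ θ := by
    refine le_trans ?_ (hg1 ▸ le1)
    calc min (setDistEdges Δf Δk) (min (setDistEdges Δg Δk) (setDistEdges Δh Δk))
        = min (min (setDistEdges Δf Δk) (setDistEdges Δg Δk)) (setDistEdges Δh Δk) := (min_assoc _ _ _).symm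
      _ ≤ min (setDistEdges (Δf ∪ Δg) Δk) (setDistEdges Δh Δk) := min_le_min (min_setDistEdges_le_union Δf Δg Δk) le_rfl
      _ ≤ setDistEdges (Δf ∪ Δg ∪ Δh) Δk := min_setDistEdges_le_union (Δf ∪ Δg) Δh Δk
  have c2 : min (setDistEdges Δf Δh) (min (setDistEdges Δg Δh) (setDistEdges Δh Δk)) ≤ θ := by
    refine le_trans ?_ (hg2 ▸ le2)
    rw [setDistEdges_comm Δh Δk]
    calc min (setDistEdges Δf Δh) (min (setDistEdges Δg Δh) (setDistEdges Δk Δh))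
        = min (min (setDistEdges Δf Δh) (setDistEdges Δg Δh)) (setDistEdges Δk Δh) := (min_assoc _ _ _).symm
      _ ≤ min (setDistEdges (Δf ∪ Δg) Δh) (setDistEdges Δk Δh) := min_le_min (min_setDistEdges_le_union Δf Δg Δh) le_rfl
      _ ≤ setDistEdges (Δf ∪ Δg ∪ Δk) Δh := min_setDistEdges_le_union (Δf ∪ Δg) Δk Δh
  have c1 : min (setDistEdges Δf Δg) (min (setDistEdges Δg Δh) (setDistEdges Δg Δk)) ≤ θ := by
    refine le_trans ?_ (hg3 ▸ le3)
    rw [setDistEdges_comm Δg Δh, setDistEdges_comm Δg Δk]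
    calc min (setDistEdges Δf Δg) (min (setDistEdges Δh Δg) (setDistEdges Δk Δg))
        = min (min (setDistEdges Δf Δg) (setDistEdges Δh Δg)) (setDistEdges Δk Δg) := (min_assoc _ _ _).symm
      _ ≤ min (setDistEdges (Δf ∪ Δh) Δg) (setDistEdges Δk Δg) := min_le_min (min_setDistEdges_le_union Δf Δh Δg) le_rfl
      _ ≤ setDistEdges (Δf ∪ Δh ∪ Δk) Δg := min_setDistEdges_le_union (Δf ∪ Δh) Δk Δg
  have c0 : min (setDistEdges Δf Δg) (min (setDistEdges Δf Δh) (setDistEdges Δf Δk)) ≤ θ := by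
    refine le_trans ?_ (hg4 ▸ le4)
    rw [setDistEdges_comm Δf Δg, setDistEdges_comm Δf Δh, setDistEdges_comm Δf Δk]
    calc min (setDistEdges Δg Δf) (min (setDistEdges Δh Δf) (setDistEdges Δk Δf))
        = min (min (setDistEdges Δg Δf) (setDistEdges Δh Δf)) (setDistEdges Δk Δf) := (min_assoc _ _ _).symm
      _ ≤ min (setDistEdges (Δg ∪ Δh) Δf) (setDistEdges Δk Δf) := min_le_min (min_setDistEdges_le_union Δg Δh Δf) le_rfl
      _ ≤ setDistEdges (Δg ∪ Δh ∪ Δk) Δf := min_setDistEdges_le_union (Δg ∪ Δh) Δk Δf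
  have c01 : min (min (setDistEdges Δf Δh) (setDistEdges Δf Δk)) (min (setDistEdges Δg Δh) (setDistEdges Δg Δk)) ≤ θ := by
    refine le_trans ?_ (hg5 ▸ le5)
    exact le_trans (min_le_min (min_setDistEdges_le_union_right Δf Δh Δk) (min_setDistEdges_le_union_right Δg Δh Δk))
      (min_setDistEdges_le_union Δf Δg (Δh ∪ Δk))
  have c02 : min (min (setDistEdges Δf Δg) (setDistEdges Δf Δk)) (min (setDistEdges Δg Δh) (setDistEdges Δh Δk)) ≤ θ := by
    refine le_trans ?_ (hg6 ▸ le6)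
    rw [setDistEdges_comm Δg Δh]
    exact le_trans (min_le_min (min_setDistEdges_le_union_right Δf Δg Δk) (min_setDistEdges_le_union_right Δh Δg Δk))
      (min_setDistEdges_le_union Δf Δh (Δg ∪ Δk))
  have c03 : min (min (setDistEdges Δf Δg) (setDistEdges Δf Δh)) (min (setDistEdges Δg Δk) (setDistEdges Δh Δk)) ≤ θ := by
    refine le_trans ?_ (hg7 ▸ le7)
    rw [setDistEdges_comm Δg Δk, setDistEdges_comm Δh Δk]
    exact le_trans (min_le_min (min_setDistEdges_le_union_right Δf Δg Δh) (min_setDistEdges_le_union_right Δk Δg Δh))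
      (min_setDistEdges_le_union Δf Δk (Δg ∪ Δh))
  have htree := exp_neg_le_treeSum ht c3 c2 c1 c0 c01 c02 c03
  exact hUθ.trans (mul_le_mul_of_nonneg_left htree (mul_nonneg h48 hB0))

end SUN

end Summit.Ventures.YMGap.RobustBall

end
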